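import Summits.HubbardSuperconductivity.HubbardSuperconductivity.Theses.ThermalWedge
import Summits.HubbardSuperconductivity.HubbardSuperconductivity.Theorems.ThermalWedgeTwSeededEnsembleEquivalenceRColdSlice
import Summits.HubbardSuperconductivity.HubbardSuperconductivity.Theorems.ThermalWedgeTwSeededEnsembleEquivalenceRColdAssembly
import Summits.HubbardSuperconductivity.HubbardSuperconductivity.Theorems.ThermalWedgeTwSeededEnsembleEquivalenceRDanskinEnvelope
import Summits.HubbardSuperconductivity.HubbardSuperconductivity.Theorems.ThermalWedgeTwSeededEnsembleEquivalenceRColdEdgeGlue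
import Summits.HubbardSuperconductivity.HubbardSuperconductivity.Theorems.ThermalWedgeTwSeededEnsembleEquivalenceRSourcedPressureLimit
import Summits.HubbardSuperconductivity.HubbardSuperconductivity.Theorems.ThermalWedgeTwSeededEnsembleEquivalenceRFreePairEnergyBandBottom
import Summits.HubbardSuperconductivity.HubbardSuperconductivity.Theorems.ThermalWedgeTwSeededEnsembleEquivalenceRFreeDensityBandBottom
import Summits.HubbardSuperconductivity.HubbardSuperconductivity.Theorems.ThermalWedgeTwSeededEnsembleEquivalenceRFreeDensityNearHalfFilling
import Summits.HubbardSuperconductivity.HubbardSuperconductivity.Theorems.ThermalWedgeTwSeededEnsembleEquivalenceROptimiserFloor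
import Summits.HubbardSuperconductivity.HubbardSuperconductivity.Theorems.ThermalWedgeTwSeededEnsembleEquivalenceRDeepGlue
import Summits.HubbardSuperconductivity.HubbardSuperconductivity.Theorems.ThermalWedgeTwSeededEnsembleEquivalenceRDeepUniqOfStrictConcavity
import Summits.HubbardSuperconductivity.HubbardSuperconductivity.Theorems.ThermalWedgeTwSeededEnsembleEquivalenceRDeepDiffOfCompressibility
import Summits.HubbardSuperconductivity.HubbardSuperconductivity.Theorems.ThermalWedgeTwSeededEnsembleEquivalenceRDeepSConcOfFiniteVolume

/-!
# Crux `TwSeededEnsembleEquivalenceR` (stmt-HubbardSuperconductivity-15581) FROM THE CONDENSATION ITEM AND THE TWO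
# REGULATED PHYSICS INPUTS: line `cold-floor-collapse` (slug `Sketch`, skeleton v7) closed modulo DEEP-DIFF and DEEP-UNIQ′

Support file (`--supports stmt-HubbardSuperconductivity-15581`; sorry-free; no definition). This is the sorry-free form of
the line's skeleton v7 (`Cruxes/TwSeededEnsembleEquivalenceR/Lines/Sketch.lean`). Cycle 3 (lead c2) implemented the card's
floor: `stub_optimiserFloor` (…ROptimiserFloor) derives from the route item `TwSourcedCondensation` (stmt-1697, ALREADY a
hypothesis of the deciding theorem `closes`) that at the cold slice `β = e^{a/U}`, with `K' := 24/(c·a)`, every maximiser of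
the AHM functional `h ↦ q(μ,h) − h²/g` over `|h| ≤ 13g+1` is a DEEP source `|h| ≥ e^{−a/(4U)}` (`≫ T = e^{−a/U}`); `stub_deepGlue`
(…RDeepGlue) re-glues the regulated physics into the landed S4a shape. Hence the route decl follows, kernel-checked, from
`TwSourcedCondensation` and EXACTLY the two regulated physics statements, taken as hypotheses with their registered stub
signatures verbatim:

* DEEP-DIFF (`stub_sourcedColdDiffDeep`): `μ`-differentiability of the cold sourced limit pressure `q(·,h)` on the window
  for DEEP sources `e^{−a/(4U)} ≤ |h| ≤ 13g+1` only;
* DEEP-UNIQ′ (`stub_sourcedColdUniqDeep`): the DEEP maximisers of `h ↦ q(μ,h) − h²/g` lie in `{h*, −h*}`;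

and, through the normal form `usc_stub_sourcedColdUniqDeep_of_deepStrictConcavity` (…RDeepUniqOfStrictConcavity), from
DEEP-DIFF + DEEP-SCONC (strict concavity of `s ↦ q(μ,√s)` on the regulated range `[e^{−a/(2U)}, (13g+1)²]`).
* `twR_of_condensation_finiteVolumeDeepRegularity` — the same from the two FINITE-VOLUME engine-facing forms
  (DEEP-E_DIFF-FV: `L`-uniform second `μ`-difference bound at deep sources; DEEP-SCONC-FV: `L`-uniform strong
  `s`-concavity modulus on the regulated range), via …RDeepDiffOfCompressibility and …RDeepSConcOfFiniteVolume.
Compared with cycle 2's `twR_of_coldDiff_coldUniq` (…ROfColdDiffUniq, whole-box DIFF/UNIQ′), the normal-state (`h = 0`)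
and BCS-critical (`|h| ≲ T`) content has left the hypotheses. [folklore composition]
-/

set_option linter.dupNamespace false

namespace Summit.HubbardSuperconductivity.HubbardSuperconductivity.Theorems.TwSeededEnsembleEquivalenceR.ColdFloorLine

open Matrix Filter Topology Finset Literature.MathematicalPhysics.QuantumLattice
open Summit.HubbardSuperconductivity.HubbardSuperconductivity.Theses.ThermalWedge
open Summit.HubbardSuperconductivity.HubbardSuperconductivity.Theorems.TwSeededEnsembleEquivalenceR.ColdFloor
open scoped ComplexOrder

noncomputable section

/-- **The crux `TwSeededEnsembleEquivalenceR` from the condensation item, DEEP-DIFF and DEEP-UNIQ′** (line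
`cold-floor-collapse`, skeleton v7: cold slice ∘ S5(S3, S1, G″(S3, GLUE(FLOOR hC, DEEP-DIFF, DEEP-UNIQ′), F1, F2, F3))).
[folklore composition] -/
theorem twR_of_condensation_deepDiff_deepUniq :
    TwSourcedCondensation →
    (∀ (μ₁ μ₂ : ℝ), -4 < μ₁ → μ₁ < μ₂ → μ₂ < 0 → ∃ a₀ : ℝ, 0 < a₀ ∧ ∀ a ∈ Set.Ioc (0 : ℝ) a₀,
      ∃ K' U₀ : ℝ, 0 < K' ∧ 0 < U₀ ∧ ∀ U ∈ Set.Ioc (0 : ℝ) U₀, ∀ g ∈ Set.Icc (K' * U) (1 / 10),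
        ∀ q : ℝ → ℝ → ℝ,
          (∀ μ ∈ Set.Icc μ₁ μ₂, ∀ h ∈ Set.Icc (-(13 * g + 1)) (13 * g + 1), ∀ κ : ℝ, 0 < κ →
            ∃ L₀ : ℕ, ∀ (L : ℕ) [NeZero L], L₀ ≤ L →
              |Real.log (Matrix.partitionFn (Real.exp (a / U)) (dWaveSourceTorus L U μ h)).re /
                  (Real.exp (a / U) * (L : ℝ) ^ 2) - q μ h| ≤ κ) →
          ∀ μ ∈ Set.Ioo μ₁ μ₂, ∀ h ∈ Set.Icc (-(13 * g + 1)) (13 * g + 1),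
            Real.exp (-(a / (4 * U))) ≤ |h| → DifferentiableAt ℝ (fun μ' => q μ' h) μ) →
    (∀ (μ₁ μ₂ : ℝ), -4 < μ₁ → μ₁ < μ₂ → μ₂ < 0 → ∃ a₁ : ℝ, 0 < a₁ ∧ ∀ a ∈ Set.Ioc (0 : ℝ) a₁,
      ∃ K' U₀ : ℝ, 0 < K' ∧ 0 < U₀ ∧ ∀ U ∈ Set.Ioc (0 : ℝ) U₀, ∀ g ∈ Set.Icc (K' * U) (1 / 10),
        ∀ q : ℝ → ℝ → ℝ,
          (∀ μ ∈ Set.Icc μ₁ μ₂, ∀ h ∈ Set.Icc (-(13 * g + 1)) (13 * g + 1), ∀ κ : ℝ, 0 < κ →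
            ∃ L₀ : ℕ, ∀ (L : ℕ) [NeZero L], L₀ ≤ L →
              |Real.log (Matrix.partitionFn (Real.exp (a / U)) (dWaveSourceTorus L U μ h)).re /
                  (Real.exp (a / U) * (L : ℝ) ^ 2) - q μ h| ≤ κ) →
          ∀ μ ∈ Set.Ioo μ₁ μ₂, ∃ hstar : ℝ, ∀ h ∈ Set.Icc (-(13 * g + 1)) (13 * g + 1),
            Real.exp (-(a / (4 * U))) ≤ |h| →
            q μ h - h ^ 2 / g =
                sSup ((fun h' : ℝ => q μ h' - h' ^ 2 / g) '' Set.Icc (-(13 * g + 1)) (13 * g + 1)) →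
              h = hstar ∨ h = -hstar) →
    TwSeededEnsembleEquivalenceR := fun hC hDiff hUniq =>
  twR_of_coldDifferentiablePressure
    (stub_coldAssembly stub_sourcedPressureLimit stub_danskinEnvelope
      (sourcedColdRegularity_of_freeFacts stub_sourcedPressureLimit
        (stub_deepGlue (stub_optimiserFloor hC) hDiff hUniq)
        stub_freePairEnergyBandBottom stub_freeDensityBandBottom stub_freeDensityNearHalfFilling))

/-- **The crux `TwSeededEnsembleEquivalenceR` from the condensation item, DEEP-DIFF and DEEP-SCONC** (strict
`s`-concavity of the cold sourced limit pressure on the REGULATED range `[e^{−a/(2U)}, (13g+1)²]`, via the normal form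
`usc_stub_sourcedColdUniqDeep_of_deepStrictConcavity`). [folklore composition] -/
theorem twR_of_condensation_deepDiff_deepStrictConcavity :
    TwSourcedCondensation →
    (∀ (μ₁ μ₂ : ℝ), -4 < μ₁ → μ₁ < μ₂ → μ₂ < 0 → ∃ a₀ : ℝ, 0 < a₀ ∧ ∀ a ∈ Set.Ioc (0 : ℝ) a₀,
      ∃ K' U₀ : ℝ, 0 < K' ∧ 0 < U₀ ∧ ∀ U ∈ Set.Ioc (0 : ℝ) U₀, ∀ g ∈ Set.Icc (K' * U) (1 / 10),
        ∀ q : ℝ → ℝ → ℝ,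
          (∀ μ ∈ Set.Icc μ₁ μ₂, ∀ h ∈ Set.Icc (-(13 * g + 1)) (13 * g + 1), ∀ κ : ℝ, 0 < κ →
            ∃ L₀ : ℕ, ∀ (L : ℕ) [NeZero L], L₀ ≤ L →
              |Real.log (Matrix.partitionFn (Real.exp (a / U)) (dWaveSourceTorus L U μ h)).re /
                  (Real.exp (a / U) * (L : ℝ) ^ 2) - q μ h| ≤ κ) →
          ∀ μ ∈ Set.Ioo μ₁ μ₂, ∀ h ∈ Set.Icc (-(13 * g + 1)) (13 * g + 1),
            Real.exp (-(a / (4 * U))) ≤ |h| → DifferentiableAt ℝ (fun μ' => q μ' h) μ) →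
    (∀ (μ₁ μ₂ : ℝ), -4 < μ₁ → μ₁ < μ₂ → μ₂ < 0 → ∃ a₁ : ℝ, 0 < a₁ ∧ ∀ a ∈ Set.Ioc (0 : ℝ) a₁,
      ∃ K' U₀ : ℝ, 0 < K' ∧ 0 < U₀ ∧ ∀ U ∈ Set.Ioc (0 : ℝ) U₀, ∀ g ∈ Set.Icc (K' * U) (1 / 10),
        ∀ q : ℝ → ℝ → ℝ,
          (∀ μ ∈ Set.Icc μ₁ μ₂, ∀ h ∈ Set.Icc (-(13 * g + 1)) (13 * g + 1), ∀ κ : ℝ, 0 < κ →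
            ∃ L₀ : ℕ, ∀ (L : ℕ) [NeZero L], L₀ ≤ L →
              |Real.log (Matrix.partitionFn (Real.exp (a / U)) (dWaveSourceTorus L U μ h)).re /
                  (Real.exp (a / U) * (L : ℝ) ^ 2) - q μ h| ≤ κ) →
          ∀ μ ∈ Set.Ioo μ₁ μ₂,
            StrictConcaveOn ℝ (Set.Icc (Real.exp (-(a / (2 * U)))) ((13 * g + 1) ^ 2))
              (fun s : ℝ => q μ (Real.sqrt s))) →
    TwSeededEnsembleEquivalenceR := fun hC hDiff hS =>
  twR_of_condensation_deepDiff_deepUniq hC hDiff (usc_stub_sourcedColdUniqDeep_of_deepStrictConcavity hS)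

/-- **The crux `TwSeededEnsembleEquivalenceR` from the condensation item and the two FINITE-VOLUME regulated
inputs** — what a convergent sourced expansion at the cold slice delivers directly: (DEEP-E_DIFF-FV) an `L`-uniform
bound on the symmetric second `μ`-difference of the sourced torus pressure at deep sources (bounded compressibility),
and (DEEP-SCONC-FV) an `L`-uniform strong-concavity modulus in the squared source on the regulated range. Composition
of `sdc_stub_sourcedColdDiffDeep_of_deepCompressibility` (…RDeepDiffOfCompressibility),
`dsc_deepStrictConcavity_of_finiteVolumeModulus` (…RDeepSConcOfFiniteVolume) and
`twR_of_condensation_deepDiff_deepStrictConcavity`. A planner filing the physics as ONE item may take the conjunction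
of the two hypotheses verbatim. [folklore composition] -/
theorem twR_of_condensation_finiteVolumeDeepRegularity :
    TwSourcedCondensation →
    (∀ (μ₁ μ₂ : ℝ), -4 < μ₁ → μ₁ < μ₂ → μ₂ < 0 → ∃ a₀ : ℝ, 0 < a₀ ∧ ∀ a ∈ Set.Ioc (0 : ℝ) a₀,
      ∃ K' U₀ : ℝ, 0 < K' ∧ 0 < U₀ ∧ ∀ U ∈ Set.Ioc (0 : ℝ) U₀, ∀ g ∈ Set.Icc (K' * U) (1 / 10),
        ∀ μ ∈ Set.Ioo μ₁ μ₂, ∀ h ∈ Set.Icc (-(13 * g + 1)) (13 * g + 1), Real.exp (-(a / (4 * U))) ≤ |h| →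
          ∃ M t₀ : ℝ, 0 < t₀ ∧ ∃ L₀ : ℕ, ∀ (L : ℕ) [NeZero L], L₀ ≤ L → ∀ t : ℝ, 0 < t → t ≤ t₀ →
            Real.log (Matrix.partitionFn (Real.exp (a / U)) (dWaveSourceTorus L U (μ + t) h)).re /
                  (Real.exp (a / U) * (L : ℝ) ^ 2) +
                Real.log (Matrix.partitionFn (Real.exp (a / U)) (dWaveSourceTorus L U (μ - t) h)).re /
                  (Real.exp (a / U) * (L : ℝ) ^ 2) -
              2 * (Real.log (Matrix.partitionFn (Real.exp (a / U)) (dWaveSourceTorus L U μ h)).re /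
                  (Real.exp (a / U) * (L : ℝ) ^ 2)) ≤ M * t ^ 2) →
    (∀ (μ₁ μ₂ : ℝ), -4 < μ₁ → μ₁ < μ₂ → μ₂ < 0 → ∃ a₁ : ℝ, 0 < a₁ ∧ ∀ a ∈ Set.Ioc (0 : ℝ) a₁,
      ∃ K' U₀ : ℝ, 0 < K' ∧ 0 < U₀ ∧ ∀ U ∈ Set.Ioc (0 : ℝ) U₀, ∀ g ∈ Set.Icc (K' * U) (1 / 10),
        ∀ μ ∈ Set.Ioo μ₁ μ₂, ∃ m : ℝ, 0 < m ∧ ∀ s₁ s₂ t : ℝ,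
          Real.exp (-(a / (2 * U))) ≤ s₁ → s₁ ≤ (13 * g + 1) ^ 2 →
          Real.exp (-(a / (2 * U))) ≤ s₂ → s₂ ≤ (13 * g + 1) ^ 2 → s₁ ≠ s₂ → 0 < t → t < 1 →
            ∃ L₀ : ℕ, ∀ (L : ℕ) [NeZero L], L₀ ≤ L →
              t * (Real.log (Matrix.partitionFn (Real.exp (a / U)) (dWaveSourceTorus L U μ (Real.sqrt s₁))).re /
                  (Real.exp (a / U) * (L : ℝ) ^ 2)) +
                (1 - t) * (Real.log (Matrix.partitionFn (Real.exp (a / U))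
                  (dWaveSourceTorus L U μ (Real.sqrt s₂))).re / (Real.exp (a / U) * (L : ℝ) ^ 2)) +
                m * t * (1 - t) * (s₁ - s₂) ^ 2 ≤
              Real.log (Matrix.partitionFn (Real.exp (a / U))
                  (dWaveSourceTorus L U μ (Real.sqrt (t * s₁ + (1 - t) * s₂)))).re /
                (Real.exp (a / U) * (L : ℝ) ^ 2)) →
    TwSeededEnsembleEquivalenceR := fun hC hE hS =>
  twR_of_condensation_deepDiff_deepStrictConcavity hC
    (sdc_stub_sourcedColdDiffDeep_of_deepCompressibility hE)
    (dsc_deepStrictConcavity_of_finiteVolumeModulus hS)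

end

end Summit.HubbardSuperconductivity.HubbardSuperconductivity.Theorems.TwSeededEnsembleEquivalenceR.ColdFloorLine
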